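import Summits.QuantumFields.YangMills.Theorems.LocalInsertionBoxAxialLipschitz
import Summits.QuantumFields.YangMills.Theorems.LocalInsertionLevelZeroUniformSU2T3
import Literature.MathematicalPhysics.QuantumFieldTheory.Balaban1983to89.T4PairDerivBridge
import HarnessLib

/-!
# Crux `HistoryTailL` (stmt-QuantumFields-19936), line #13 height one — K1♭ (B): GAUSSIAN CONCENTRATION OF LOCAL GAUGE-INVARIANT LIPSCHITZ
# OBSERVABLES ON BOXES OF BOUNDED SIDE, γ-FREE CONSTANTS (the text of `MesoscopicConcentrationL` with the single extra guard `n ≤ N₀`)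

Cell `ym3-torus` (YM ladder rung R3 = continuum SU(2) Yang–Mills on the 3-torus — NOT d = 4, NOT infinite volume, NOT a mass gap, NOT the Clay
problem), width seat `ym-ust-19936-w7` gen 10, LEAD ★w1-19936 g8 WORD 1 «K1♭ GO» (03:14Z); `--supports stmt-QuantumFields-19936 --as helper`.

The crux `MesoscopicConcentrationL` (stmt-QuantumFields-23532, route PoincareLipschitz) asks, for every `L`, constants `Cc, cc, γ₁` with
`gibbsK{r ≤ f − ∫f} ≤ Cc·exp(−cc·β_K·r²∕(n²Λ²))` for EVERY box side `1 ≤ n ≤ β_K` and every local, gauge-invariant, `Λ`-Lipschitz `f` on the box —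
a log-Sobolev-type statement at mesoscopic scales (XL; NOT claimed, NOT restated, NOT proved here).  Its height-one consumer
(✓`LocalInsertionWindowTailOfConcentration.windowTail_step`, lines 215∕247) instantiates it at ONE bounded side, `n = 17L`.  ★`boxConcentration_bounded`
below is that text VERBATIM with the single extra guard `n ≤ N₀` (constants depending on `N₀`), proved by the crude route that the PREFACTOR-FREE
level-0 plaquette tail ✓`LevelZeroUniformSU2T3.exists_gibbsK_real_dist1_ge_le` (`gibbsK{θ ≤ dist1 U(∂p)} ≤ e^{A}e^{−β_Kθ²∕8}`, NO power of `β_K`) makes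
available: axial gauge on the box (✓`BoxAxialLipschitz.abs_sub_apply_one_le_of_box_plaqSmall`: `|f U − f 1| ≤ Λ·M·δ` when the ≤ `9n³` box plaquettes are
within `δ` of `1`) + union bound (`gibbsK{θ < |f − f 1|} ≤ 9n³e^{A}e^{−β_Kθ²∕(8Λ²M²)}`) + layer cake for the centring (`|∫f − f 1| ≤ Λ·M·C₂∕√β_K`,
✓`integral_le_of_gaussian_tail`) + the two-case split at `r = 2·(centring)`.  The `n`-dependence of the crude exponent is absorbed in `cc(N₀)`; `γ₁ = 1∕8`
(`β_K = (γ ε_K)⁻¹ ≥ 8`).  HONEST: a COROLLARY of the level-0 lane for BOUNDED boxes — a STANDALONE level-0 letter with NO CONSUMER IN THE TREE TODAY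
(LEAD WORDS 7∕8, 03:33∕03:39Z: the height-one stub was closed DIRECTLY by ★w4 g11's `LocalInsertionStubHeightOne` — bounded-height tail ∘ the
prefactor-free level-0 tail — superseding the K1-road this letter was typed for); the mesoscopic statement (`cc` independent of `n ≤ β_K`, the organ K1)
is untouched; nothing of the stubs or the crux is proved.  THEOREMS ONLY, definition-free. [cite: Balaban1985UV3, (3) p.256 and (39)-(40) p.266]
-/

set_option autoImplicit false

noncomputable section

open scoped BigOperators
open MeasureTheory
open Literature.MathematicalPhysics.QuantumFieldTheory
open Literature.MathematicalPhysics.QuantumFieldTheory.Balaban1983to89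
open Literature.MathematicalPhysics.QuantumFieldTheory.Balaban1983to89.T3ContinuumYM3Torus
open Literature.MathematicalPhysics.QuantumFieldTheory.Balaban1983to89.T3UnitScaleTilt
open Literature.MathematicalPhysics.QuantumFieldTheory.Balaban1983to89.T3UnitLawDensityEML
open Literature.MathematicalPhysics.QuantumFieldTheory.Balaban1983to89.T4PairDerivBridge (dist1_le_two_specialUnitaryGroup)
open Summit.QuantumFields.YangMills.Theorems.LocalInsertion.BoxAxialLipschitz (abs_sub_apply_one_le_of_box_plaqSmall card_filter_plaq_box_le)
open Summit.QuantumFields.YangMills.Theorems.LocalInsertion.ExpMomentSU2UniformT3 (integral_le_of_gaussian_tail)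
open Summit.QuantumFields.YangMills.Theorems.LocalInsertion.LevelZeroUniformSU2T3 (exists_gibbsK_real_dist1_ge_le)

namespace Summit.QuantumFields.YangMills.Theorems.LocalInsertion.BoxConcentrationBounded

/-! ## §1 Arithmetic of the constants -/

/-- The deterministic factor `√(3n³)·(2(n−1))` of the box of side `n ≤ N₀` (d = 3) is at most `Mf(N₀) := √(3N₀³)·(2N₀) + 1`. [folklore] -/
theorem factor_le (N₀ : ℕ) {n : ℕ} (hn : n ≤ N₀) :
    Real.sqrt ((3 : ℝ) * (n : ℝ) ^ 3) * ((((3 - 1 : ℕ) : ℝ)) * (((n - 1 : ℕ) : ℝ))) ≤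
      Real.sqrt ((3 : ℝ) * (N₀ : ℝ) ^ 3) * (2 * (N₀ : ℝ)) + 1 := by
  have hn' : (n : ℝ) ≤ N₀ := by exact_mod_cast hn
  have h1 : Real.sqrt ((3 : ℝ) * (n : ℝ) ^ 3) ≤ Real.sqrt ((3 : ℝ) * (N₀ : ℝ) ^ 3) :=
    Real.sqrt_le_sqrt (by gcongr)
  have h2 : ((((3 - 1 : ℕ) : ℝ)) * (((n - 1 : ℕ) : ℝ))) ≤ 2 * (N₀ : ℝ) := by
    have : (((n - 1 : ℕ) : ℝ)) ≤ (N₀ : ℝ) := by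
      have : n - 1 ≤ N₀ := by omega
      exact_mod_cast this
    norm_num
    linarith
  have h3 : 0 ≤ ((((3 - 1 : ℕ) : ℝ)) * (((n - 1 : ℕ) : ℝ))) := by positivity
  calc _ ≤ Real.sqrt ((3 : ℝ) * (N₀ : ℝ) ^ 3) * (2 * (N₀ : ℝ)) :=
        mul_le_mul h1 h2 h3 (Real.sqrt_nonneg _)
    _ ≤ _ := by linarith

/-! ## §2 The box concentration at bounded side -/

set_option maxHeartbeats 400000 in -- one long assembly (constants, union bound, layer cake, two cases); > 100k heartbeats
/-- ★ **K1♭ — GAUSSIAN CONCENTRATION ON BOXES OF BOUNDED SIDE, γ-FREE.**  For every `L` and every `N₀` there are `Cc ≥ 0`, `cc > 0`, `γ₁ ∈ (0,1]` such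
that for every `T3Family F` with `F.L = L`, every `γ ∈ (0, γ₁]`, every cut-off `K`, every box side `1 ≤ n ≤ N₀` (with K1's guards `n ≤ β_K`,
`2n ≤ sitesPerDir`), every corner `x₀`, and every measurable, gauge-invariant `f` of the level-0 field that depends only on the bonds with both ends in the
box `x₀ + [0,n)³` and is `Λ`-Lipschitz (`Λ > 0`) in the `ℓ²` link metric:  `gibbsK{r ≤ f − ∫f} ≤ Cc·exp(−cc·β_K·r²∕(n²Λ²))` for all `r ≥ 0` — the text of
`PoincareLipschitz.MesoscopicConcentrationL` VERBATIM plus the guard `n ≤ N₀` (constants depend on `N₀`; they do not even depend on `L`).  Proof: the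
prefactor-free level-0 plaquette tail, axial gauge on the box, union bound, layer cake.  No consumer in the tree today (the height-one stub is closed
directly); K1 at mesoscopic side is NOT this. [cite: Balaban1985UV3, (3) p.256 and (39)-(40) p.266] -/
theorem boxConcentration_bounded : ∀ (L N₀ : ℕ), ∃ (Cc cc : ℝ), 0 ≤ Cc ∧ 0 < cc ∧ ∃ γ₁ : ℝ, 0 < γ₁ ∧ γ₁ ≤ 1 ∧
    ∀ (F : T3Family) (γ : ℝ), F.L = L → 0 < γ → γ ≤ γ₁ → ∀ (K n : ℕ), 1 ≤ n → n ≤ N₀ →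
      (n : ℝ) ≤ (F.scheme ℰp γ).β K → 2 * n ≤ (F.P K).sitesPerDir 0 →
      ∀ (x₀ : Site (F.P K) 0) (f : GaugeField (F.P K) 0 (Matrix.specialUnitaryGroup (Fin 2) ℂ) → ℝ) (Λ : ℝ), 0 < Λ →
        Measurable f → GaugeField.GaugeInvariant f →
        (∀ U U' : GaugeField (F.P K) 0 (Matrix.specialUnitaryGroup (Fin 2) ℂ),
          (∀ b : PBond (F.P K) 0, (∀ k, (b.src k - x₀ k).val < n) → (∀ k, (b.tgt k - x₀ k).val < n) → U b = U' b) → f U = f U') →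
        (∀ U U' : GaugeField (F.P K) 0 (Matrix.specialUnitaryGroup (Fin 2) ℂ),
          |f U - f U'| ≤ Λ * Real.sqrt (∑ b : PBond (F.P K) 0, GaugeGroup.dist1 (U b * (U' b)⁻¹) ^ 2)) →
        ∀ r : ℝ, 0 ≤ r →
          (gibbsK F ℰp γ K).real {U | r ≤ f U - ∫ V, f V ∂(gibbsK F ℰp γ K)} ≤
            Cc * Real.exp (-(cc * (F.scheme ℰp γ).β K * r ^ 2 / ((n : ℝ) ^ 2 * Λ ^ 2))) := by
  intro L N₀
  obtain ⟨A, hA⟩ := exists_gibbsK_real_dist1_ge_le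
  -- the constants
  set E : ℝ := Real.exp A with hE
  have hE0 : 0 < E := Real.exp_pos A
  set Mf : ℝ := Real.sqrt ((3 : ℝ) * (N₀ : ℝ) ^ 3) * (2 * (N₀ : ℝ)) + 1 with hMf
  have hMf0 : 0 < Mf := by positivity
  set Np : ℝ := 9 * (N₀ : ℝ) ^ 3 + 1 with hNp
  have hNp0 : 0 < Np := by positivity
  set cc : ℝ := 1 / (32 * Mf ^ 2) with hcc
  have hcc0 : 0 < cc := by positivity
  set E₀ : ℝ := Real.pi * Np ^ 2 * E ^ 2 / 4 with hE₀
  set Cc : ℝ := Np * E + Real.exp E₀ with hCc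
  have hCc1 : Real.exp E₀ ≤ Cc := le_add_of_nonneg_left (by positivity)
  have hCc2 : Np * E ≤ Cc := le_add_of_nonneg_right (Real.exp_pos _).le
  refine ⟨Cc, cc, by positivity, hcc0, 1 / 8, by norm_num, by norm_num, ?_⟩
  intro F γ hFL hγ hγ8 K n hn hnN₀ hnβ h2n x₀ f Λ hΛ hfm hinv hloc hLip r hr
  -- the measure and the coupling
  haveI := isProbabilityMeasure_gibbsK F ℰp hγ.le K
  set μ := gibbsK F ℰp γ K with hμ
  set β : ℝ := (F.scheme ℰp γ).β K with hβ
  have hβ8 : 8 ≤ β := by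
    -- `β_K = (γ ε_K)⁻¹ ≥ 8` for `γ ≤ 1∕8`, `ε_K ≤ 1` (the tree's `BoundedHeightTailUniform.eight_le_scheme_β`, inlined)
    have hβe : β = (γ * (F.P K).eps)⁻¹ := rfl
    have hε0 : 0 < (F.P K).eps := (F.P K).eps_pos
    have hε1 : (F.P K).eps ≤ 1 := by
      have hL : (1 : ℝ) ≤ ((F.P K).L : ℝ) := by exact_mod_cast (F.P K).hL.2.le
      unfold Params.eps
      exact pow_le_one₀ (inv_nonneg.2 (by positivity)) (inv_le_one_of_one_le₀ hL)
    rw [hβe, le_inv_comm₀ (by norm_num) (mul_pos hγ hε0)]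
    calc γ * (F.P K).eps ≤ 1 / 8 * 1 := mul_le_mul hγ8 hε1 hε0.le (by norm_num)
      _ = 8⁻¹ := by norm_num
  have hβ0 : 0 < β := by linarith
  have hd : (F.P K).d = 3 := T3Family.P_d F K
  -- §a the deterministic input: all box plaquettes within `δ` ⇒ `|f U − f 1| ≤ M₁ δ`, `M₁ := Λ·Mf`
  set M₁ : ℝ := Λ * Mf with hM₁
  have hM₁0 : 0 < M₁ := mul_pos hΛ hMf0
  have hdet : ∀ (δ : ℝ), 0 ≤ δ → ∀ U : GaugeField (F.P K) 0 (Matrix.specialUnitaryGroup (Fin 2) ℂ),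
      (∀ q : Plaq (F.P K) 0, (∀ k, (q.src k - x₀ k).val < n) → dist1 (GaugeField.plaqHol U q) < δ) → |f U - f 1| ≤ M₁ * δ := by
    intro δ hδ U hU
    have h := abs_sub_apply_one_le_of_box_plaqSmall x₀ hn h2n f hΛ.le hinv hloc hLip hδ U hU
    rw [hd] at h
    have hfac := factor_le N₀ hnN₀
    calc |f U - f 1| ≤ Λ * (Real.sqrt ((3 : ℝ) * (n : ℝ) ^ 3) * ((((3 - 1 : ℕ) : ℝ)) * (((n - 1 : ℕ) : ℝ)))) * δ := by
          simpa using h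
      _ ≤ Λ * Mf * δ := by
          refine mul_le_mul_of_nonneg_right (mul_le_mul_of_nonneg_left hfac hΛ.le) hδ
      _ = M₁ * δ := by rw [hM₁]
  -- §b the tail of `g := |f − f 1|` by the union bound over the ≤ `9n³` box plaquettes and the prefactor-free plaquette tail
  classical
  set Q : Finset (Plaq (F.P K) 0) := Finset.univ.filter fun q => ∀ k, (q.src k - x₀ k).val < n with hQ
  have hQcard : (Q.card : ℝ) ≤ Np := by
    have h1 : Q.card ≤ (F.P K).d ^ 2 * n ^ (F.P K).d := card_filter_plaq_box_le x₀ n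
    rw [hd] at h1
    have h2 : ((Q.card : ℕ) : ℝ) ≤ ((3 ^ 2 * n ^ 3 : ℕ) : ℝ) := by exact_mod_cast h1
    have h3 : (n : ℝ) ^ 3 ≤ (N₀ : ℝ) ^ 3 := pow_le_pow_left₀ (by positivity) (by exact_mod_cast hnN₀) 3
    push_cast at h2
    rw [hNp]; linarith
  set g : GaugeField (F.P K) 0 (Matrix.specialUnitaryGroup (Fin 2) ℂ) → ℝ := fun U => |f U - f 1| with hg
  have hg0 : ∀ U, 0 ≤ g U := fun U => abs_nonneg _
  have htail : ∀ θ : ℝ, 0 < θ → μ.real {U | θ < g U} ≤ (Np * E) * Real.exp (-(β / (8 * M₁ ^ 2)) * θ ^ 2) := by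
    intro θ hθ
    set δ : ℝ := θ / M₁ with hδ
    have hδ0 : 0 < δ := div_pos hθ hM₁0
    -- `{θ < g} ⊆ ⋃_{q ∈ Q} {δ ≤ dist1 U(∂q)}`
    have hsub : {U | θ < g U} ⊆ ⋃ q ∈ Q, {U | δ ≤ dist1 (GaugeField.plaqHol U q)} := by
      intro U hU
      simp only [Set.mem_setOf_eq] at hU
      by_contra hnot
      simp only [Set.mem_iUnion, Set.mem_setOf_eq, not_exists, not_le] at hnot
      have hall : ∀ q : Plaq (F.P K) 0, (∀ k, (q.src k - x₀ k).val < n) → dist1 (GaugeField.plaqHol U q) < δ :=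
        fun q hq => hnot q (by rw [hQ]; simpa using hq)
      have h := hdet δ hδ0.le U hall
      have : M₁ * δ = θ := by rw [hδ]; field_simp
      rw [this] at h
      exact absurd hU (not_lt.2 h)
    calc μ.real {U | θ < g U} ≤ μ.real (⋃ q ∈ Q, {U | δ ≤ dist1 (GaugeField.plaqHol U q)}) :=
          measureReal_mono hsub (measure_ne_top _ _)
      _ ≤ ∑ q ∈ Q, μ.real {U | δ ≤ dist1 (GaugeField.plaqHol U q)} := measureReal_biUnion_finset_le Q _
      _ ≤ ∑ _q ∈ Q, E * Real.exp (-(1 / 2 * (β / 2) * δ ^ 2 / 2)) :=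
          Finset.sum_le_sum fun q _ => by rw [hμ, hE, hβ]; exact hA F ℰp γ K hβ8 δ hδ0.le q
      _ = (Q.card : ℝ) * (E * Real.exp (-(1 / 2 * (β / 2) * δ ^ 2 / 2))) := by rw [Finset.sum_const, nsmul_eq_mul]
      _ ≤ Np * (E * Real.exp (-(1 / 2 * (β / 2) * δ ^ 2 / 2))) := mul_le_mul_of_nonneg_right hQcard (by positivity)
      _ = (Np * E) * Real.exp (-(β / (8 * M₁ ^ 2)) * θ ^ 2) := by
          have hexp : -(1 / 2 * (β / 2) * δ ^ 2 / 2) = -(β / (8 * M₁ ^ 2)) * θ ^ 2 := by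
            rw [hδ]; field_simp; ring
          rw [hexp, mul_assoc]
  -- §c the centring: `|∫f − f 1| ≤ m := Np·E·√(π ∕ (β∕(8M₁²)))∕2`
  have hcpos : 0 < β / (8 * M₁ ^ 2) := by positivity
  set m : ℝ := (Np * E) * (Real.sqrt (Real.pi / (β / (8 * M₁ ^ 2))) / 2) with hm
  have hm0 : 0 ≤ m := by positivity
  have hgint : ∫ U, g U ∂μ ≤ m := integral_le_of_gaussian_tail hg0 (by positivity) hcpos htail
  have hbound : ∀ U, |f U| ≤ |f 1| + Λ * Real.sqrt (∑ _b : PBond (F.P K) 0, (2 : ℝ) ^ 2) := by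
    intro U
    have h1 := hLip U 1
    have h2 : Real.sqrt (∑ b : PBond (F.P K) 0, GaugeGroup.dist1 (U b * ((1 : GaugeField (F.P K) 0 _) b)⁻¹) ^ 2) ≤
        Real.sqrt (∑ _b : PBond (F.P K) 0, (2 : ℝ) ^ 2) := by
      refine Real.sqrt_le_sqrt (Finset.sum_le_sum fun b _ => ?_)
      exact pow_le_pow_left₀ (GaugeGroup.dist1_nonneg _) (dist1_le_two_specialUnitaryGroup _) 2
    have h3 : |f U - f 1| ≤ Λ * Real.sqrt (∑ _b : PBond (F.P K) 0, (2 : ℝ) ^ 2) := h1.trans (mul_le_mul_of_nonneg_left h2 hΛ.le)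
    have := abs_sub_abs_le_abs_sub (f U) (f 1)
    linarith
  have hfint : Integrable f μ :=
    Integrable.mono' (integrable_const (|f 1| + Λ * Real.sqrt (∑ _b : PBond (F.P K) 0, (2 : ℝ) ^ 2))) hfm.aestronglyMeasurable
      (ae_of_all _ fun U => by rw [Real.norm_eq_abs]; exact hbound U)
  have hcentre : |∫ V, f V ∂μ - f 1| ≤ m := by
    have h1 : ∫ V, f V ∂μ - f 1 = ∫ V, (f V - f 1) ∂μ := by
      rw [integral_sub hfint (integrable_const _), integral_const, smul_eq_mul, probReal_univ, one_mul]
    rw [h1]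
    calc |∫ V, (f V - f 1) ∂μ| ≤ ∫ V, |f V - f 1| ∂μ := abs_integral_le_integral_abs
      _ ≤ m := hgint
  -- §d the two cases
  have hLHS1 : μ.real {U | r ≤ f U - ∫ V, f V ∂μ} ≤ 1 := measureReal_le_one
  by_cases hr2 : r ≤ 2 * m
  · -- small `r`: the claimed bound is `≥ 1`
    have hx : cc * β * r ^ 2 / ((n : ℝ) ^ 2 * Λ ^ 2) ≤ E₀ := by
      have hn1 : (1 : ℝ) ≤ (n : ℝ) := by exact_mod_cast hn
      have hn1sq : 1 * Λ ^ 2 ≤ (n : ℝ) ^ 2 * Λ ^ 2 := mul_le_mul_of_nonneg_right (one_le_pow₀ hn1) (sq_nonneg Λ)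
      have hr2' : r ^ 2 ≤ (2 * m) ^ 2 := pow_le_pow_left₀ hr hr2 2
      have hx0 : 0 ≤ Real.pi / (β / (8 * M₁ ^ 2)) := by positivity
      have hmsq : (2 * m) ^ 2 = Np ^ 2 * E ^ 2 * (Real.pi / (β / (8 * M₁ ^ 2))) := by
        rw [hm]
        have h2 : 2 * (Np * E * (Real.sqrt (Real.pi / (β / (8 * M₁ ^ 2))) / 2)) =
            Np * E * Real.sqrt (Real.pi / (β / (8 * M₁ ^ 2))) := by ring
        rw [h2, mul_pow, mul_pow, Real.sq_sqrt hx0]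
      have hnum0 : 0 ≤ cc * β * (2 * m) ^ 2 := by positivity
      calc cc * β * r ^ 2 / ((n : ℝ) ^ 2 * Λ ^ 2) ≤ cc * β * (2 * m) ^ 2 / ((n : ℝ) ^ 2 * Λ ^ 2) := by gcongr
        _ ≤ cc * β * (2 * m) ^ 2 / (1 * Λ ^ 2) := div_le_div_of_nonneg_left hnum0 (by positivity) hn1sq
        _ = E₀ := by rw [hmsq, hcc, hE₀, hM₁]; field_simp; ring
    calc μ.real {U | r ≤ f U - ∫ V, f V ∂μ} ≤ 1 := hLHS1
      _ ≤ Real.exp E₀ * Real.exp (-(cc * β * r ^ 2 / ((n : ℝ) ^ 2 * Λ ^ 2))) := by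
          rw [← Real.exp_add]; exact Real.one_le_exp (by linarith)
      _ ≤ Cc * Real.exp (-(cc * β * r ^ 2 / ((n : ℝ) ^ 2 * Λ ^ 2))) := mul_le_mul_of_nonneg_right hCc1 (Real.exp_pos _).le
  · -- large `r`: `{r ≤ f − ∫f} ⊆ {r∕2 < g}`
    replace hr2 : 2 * m < r := not_le.1 hr2
    have hsub : {U | r ≤ f U - ∫ V, f V ∂μ} ⊆ {U | r / 2 < g U} := by
      intro U hU
      simp only [Set.mem_setOf_eq] at hU ⊢
      have h1 : f U - f 1 = (f U - ∫ V, f V ∂μ) + (∫ V, f V ∂μ - f 1) := by ring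
      have h2 : -m ≤ ∫ V, f V ∂μ - f 1 := (abs_le.1 hcentre).1
      calc r / 2 < r - m := by linarith
        _ ≤ f U - f 1 := by rw [h1]; linarith
        _ ≤ g U := le_abs_self _
    have hθ : 0 < r / 2 := by linarith
    have hstep1 : μ.real {U | r ≤ f U - ∫ V, f V ∂μ} ≤ μ.real {U | r / 2 < g U} :=
      measureReal_mono hsub (measure_ne_top _ _)
    have hstep2 : μ.real {U | r / 2 < g U} ≤ (Np * E) * Real.exp (-(β / (8 * M₁ ^ 2)) * (r / 2) ^ 2) := htail (r / 2) hθ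
    -- `cc·β·r²∕(n²Λ²) ≤ β r²∕(32 Λ² Mf²) = (β∕(8M₁²))·(r∕2)²` since `n ≥ 1`, `cc = 1∕(32 Mf²)`
    have hn1 : (1 : ℝ) ≤ (n : ℝ) := by exact_mod_cast hn
    have hn1sq : 1 * Λ ^ 2 ≤ (n : ℝ) ^ 2 * Λ ^ 2 := mul_le_mul_of_nonneg_right (one_le_pow₀ hn1) (sq_nonneg Λ)
    have hnum0 : 0 ≤ cc * β * r ^ 2 := by positivity
    have hkey : cc * β * r ^ 2 / ((n : ℝ) ^ 2 * Λ ^ 2) ≤ cc * β * r ^ 2 / (1 * Λ ^ 2) :=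
      div_le_div_of_nonneg_left hnum0 (by positivity) hn1sq
    have heq : β / (8 * M₁ ^ 2) * (r / 2) ^ 2 = cc * β * r ^ 2 / (1 * Λ ^ 2) := by
      rw [hcc, hM₁]; field_simp; ring
    have hstep3 : (Np * E) * Real.exp (-(β / (8 * M₁ ^ 2)) * (r / 2) ^ 2) ≤
        Cc * Real.exp (-(cc * β * r ^ 2 / ((n : ℝ) ^ 2 * Λ ^ 2))) := by
      refine mul_le_mul hCc2 (Real.exp_le_exp.2 ?_) (Real.exp_pos _).le (by positivity)
      rw [neg_mul, heq]
      exact neg_le_neg hkey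
    exact hstep1.trans (hstep2.trans hstep3)

end Summit.QuantumFields.YangMills.Theorems.LocalInsertion.BoxConcentrationBounded

end
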